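import Summits.Ventures.PercRepro.RankLevelSetBiIndepUpSet
import Summits.Ventures.PercRepro.RankLevelSetBiIndepParallel
import Summits.Ventures.PercRepro.RankLevelSetBiIndepAvoidNormSkew

/-! # RankLevelSetInOutParallel — (IO) IS CLOSED UNDER PARALLEL EXTENSION, UNCONDITIONALLY: FOR A PARALLEL PAIR
`{y, z}` OF `M` AND `N = M ／ {y} ＼ {z}`, `BiIndepInOutNormSkew N → BiIndepInOutNormSkew M` (night-1 g33;
dossier §45.8 (e))

For a parallel pair `{y, z}` (g25's `ParallelPair`) every bi-independent set of `M` contains exactly one of `y, z`,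
and `S ↦ S ∖ {y}` (resp. `S ∖ {z}`) is a bijection onto the bi-independent sets of `N = M ／ {y} ＼ {z}` one level
down (g25's `ncard_biIndep_mem_left_eq` / `_right_eq`). THE CLOSURES: for `X ⊆ E(N)`,
`cl_M (X ∪ {y}) = cl_M (X ∪ {z}) = cl_N X ∪ {y, z}` (**`closure_insert_eq_contract_delete`**,
**`closure_insert_right_eq_contract_delete`**), so for a family `U` up-closed among the flats of `M` the family
`parCut y z U = {F : F ∪ {y, z} ∈ U}` is up-closed among the flats of `N` (**`upSetFlats_parCut`**) and the in-out
condition of `T ∪ {y}` (or `T ∪ {z}`) in `(M, U)` is the in-out condition of `T` in `(N, parCut y z U)`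
(**`inOut_insert_iff`**). Hence `inOutCount M U (j + 1) = 2 · inOutCount N (parCut y z U) j` and
`inOutCount M U 0 = 0` (**`inOutCount_succ_of_parallel`**): the in-out profile of `M` is twice the shifted profile of
`N`, and g31's `normSkew_shift` turns `NormSkew (·; #E − 2 + 1)` into `NormSkew (·; #E + 1)` — no Mono hypothesis,
unlike (ABS-norm)'s parallel closure (g32). THEOREM **`biIndepInOutNormSkew_of_parallel`**. With
`RankLevelSetBoolInOutFree`, (IO) holds on every matroid reached from a uniform matroid by iterated parallel
coextensions. Every declaration has a docstring; imports: the cell's own modules and Mathlib only. Axioms: standard. -/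

namespace PercRepro

open Set Matroid

variable {α : Type} (M : Matroid α) [M.Finite]

/-! ## Closures through a parallel pair -/

omit [M.Finite] in
/-- **`cl_M (X ∪ {y}) = cl_N X ∪ {y, z}`** for `X ⊆ E(N)`, `N = M ／ {y} ＼ {z}`. -/
lemma closure_insert_eq_contract_delete {y z : α} (h : ParallelPair M y z) {X : Set α}
    (hX : X ⊆ ((M.contract {y}).delete {z}).E) :
    M.closure (insert y X) = ((M.contract {y}).delete {z}).closure X ∪ {y, z} := by
  have hzX : z ∉ X := fun hz => by
    have := hX hz; rw [ground_contract_delete] at this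
    exact this.2 (Set.mem_insert_of_mem y rfl)
  have hN : ((M.contract {y}).delete {z}).closure X = M.closure (insert y X) \ {y, z} := by
    rw [Matroid.delete_closure_eq, Matroid.contract_closure_eq, Set.sdiff_singleton_eq_self hzX,
      Set.union_singleton, Set.sdiff_sdiff, Set.singleton_union]
  have hy : y ∈ M.closure (insert y X) :=
    M.subset_closure (insert y X) (Set.insert_subset h.2.1.mem_ground
      (hX.trans (by rw [ground_contract_delete]; exact Set.sdiff_subset))) (Set.mem_insert y X)
  have hz : z ∈ M.closure (insert y X) :=
    M.closure_subset_closure (Set.singleton_subset_iff.mpr (Set.mem_insert y X)) h.mem_closure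
  rw [hN, Set.sdiff_union_of_subset (Set.pair_subset hy hz)]

omit [M.Finite] in
/-- **`cl_M (X ∪ {z}) = cl_M (X ∪ {y})`** for a parallel pair. -/
lemma closure_insert_right_eq {y z : α} (h : ParallelPair M y z) (X : Set α) :
    M.closure (insert z X) = M.closure (insert y X) := by
  have hz : z ∈ M.closure (insert y X) :=
    M.closure_subset_closure (Set.singleton_subset_iff.mpr (Set.mem_insert y X)) h.mem_closure
  have hy : y ∈ M.closure (insert z X) :=
    M.closure_subset_closure (Set.singleton_subset_iff.mpr (Set.mem_insert z X)) h.symm.mem_closure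
  calc M.closure (insert z X) = M.closure (insert y (insert z X)) :=
        (Matroid.closure_insert_eq_of_mem_closure hy).symm
    _ = M.closure (insert z (insert y X)) := by rw [Set.insert_comm]
    _ = M.closure (insert y X) := Matroid.closure_insert_eq_of_mem_closure hz

omit [M.Finite] in
/-- **`cl_M (X ∪ {z}) = cl_N X ∪ {y, z}`** for `X ⊆ E(N)`. -/
lemma closure_insert_right_eq_contract_delete {y z : α} (h : ParallelPair M y z) {X : Set α}
    (hX : X ⊆ ((M.contract {y}).delete {z}).E) :
    M.closure (insert z X) = ((M.contract {y}).delete {z}).closure X ∪ {y, z} := by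
  rw [closure_insert_right_eq M h, closure_insert_eq_contract_delete M h hX]

/-! ## The filter through the pair -/

omit [M.Finite] in
/-- **The filter through the parallel pair**: the sets `F` with `F ∪ {y, z} ∈ U`. -/
def parCut (y z : α) (U : Set (Set α)) : Set (Set α) := {F | F ∪ {y, z} ∈ U}

omit [M.Finite] in
/-- A flat `G` of `N = M ／ {y} ＼ {z}` gives the flat `G ∪ {y, z}` of `M`. -/
lemma isFlat_union_pair {y z : α} (h : ParallelPair M y z) {G : Set α}
    (hG : ((M.contract {y}).delete {z}).IsFlat G) : M.IsFlat (G ∪ {y, z}) := by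
  rw [Matroid.isFlat_iff_closure_eq]
  have hGE : G ⊆ ((M.contract {y}).delete {z}).E := hG.subset_ground
  have hz : z ∈ M.closure (insert y G) := by
    rw [closure_insert_eq_contract_delete M h hGE]; exact Or.inr (Set.mem_insert_of_mem y rfl)
  calc M.closure (G ∪ {y, z}) = M.closure (insert z (insert y G)) := by
        congr 1; ext x; simp only [Set.mem_union, Set.mem_insert_iff, Set.mem_singleton_iff]; tauto
    _ = M.closure (insert y G) := Matroid.closure_insert_eq_of_mem_closure hz
    _ = G ∪ {y, z} := by rw [closure_insert_eq_contract_delete M h hGE, hG.closure]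

omit [M.Finite] in
/-- The filter through the pair is up-closed among the flats of `N` when `U` is up-closed among those of `M`. -/
lemma upSetFlats_parCut {y z : α} (h : ParallelPair M y z) {U : Set (Set α)} (hU : UpSetFlats M U) :
    UpSetFlats ((M.contract {y}).delete {z}) (parCut y z U) := by
  intro F hF G hG hFG
  exact hU _ hF _ (isFlat_union_pair M h hG) (Set.union_subset_union_left _ hFG)

omit [M.Finite] in
/-- **The in-out condition through the pair**: for `T ⊆ E(N)` with `w ∈ {y, z}`, `T ∪ {w}` is in-out for `(M, U)`
iff `T` is in-out for `(N, parCut y z U)`. -/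
lemma inOut_insert_iff {y z : α} (h : ParallelPair M y z) (U : Set (Set α)) {T : Set α}
    (hT : T ⊆ ((M.contract {y}).delete {z}).E) {w : α} (hw : w = y ∨ w = z) :
    (M.closure (insert w T) ∈ U ∧ M.closure (M.E \ insert w T) ∉ U) ↔
      (((M.contract {y}).delete {z}).closure T ∈ parCut y z U ∧
        ((M.contract {y}).delete {z}).closure (((M.contract {y}).delete {z}).E \ T) ∉ parCut y z U) := by
  have hT' : T ⊆ M.E \ {y, z} := by rwa [ground_contract_delete] at hT
  have hcl : M.closure (insert w T) = ((M.contract {y}).delete {z}).closure T ∪ {y, z} := by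
    rcases hw with rfl | rfl
    · exact closure_insert_eq_contract_delete M h hT
    · exact closure_insert_right_eq_contract_delete M h hT
  have hcompl : M.closure (M.E \ insert w T) =
      ((M.contract {y}).delete {z}).closure (((M.contract {y}).delete {z}).E \ T) ∪ {y, z} := by
    rcases hw with rfl | rfl
    · rw [compl_insert_eq M h.1 h.2.2.1.mem_ground hT', ← ground_contract_delete]
      exact closure_insert_right_eq_contract_delete M h Set.sdiff_subset
    · rw [compl_insert_eq M h.1.symm h.2.1.mem_ground (by rwa [Set.pair_comm]), Set.pair_comm,
        ← ground_contract_delete]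
      exact closure_insert_eq_contract_delete M h Set.sdiff_subset
  rw [hcl, hcompl]
  rfl

/-! ## The profile through the pair -/

/-- **The in-out profile of `M` is twice the shifted profile of `N`**:
`inOutCount M U (j + 1) = 2 · inOutCount N (parCut y z U) j`. -/
lemma inOutCount_succ_of_parallel {y z : α} (h : ParallelPair M y z) (U : Set (Set α)) (j : ℕ) :
    inOutCount M U (j + 1) = 2 * inOutCount ((M.contract {y}).delete {z}) (parCut y z U) j := by
  unfold inOutCount
  rw [ncard_biIndep_split M h (j + 1) (fun S => M.closure S ∈ U ∧ M.closure (M.E \ S) ∉ U),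
    ncard_biIndep_mem_left_eq M h j, ncard_biIndep_mem_right_eq M h j]
  have hl : {T ∈ biIndep ((M.contract {y}).delete {z}) j |
      M.closure (insert y T) ∈ U ∧ M.closure (M.E \ insert y T) ∉ U} =
      {T ∈ biIndep ((M.contract {y}).delete {z}) j | ((M.contract {y}).delete {z}).closure T ∈ parCut y z U ∧
        ((M.contract {y}).delete {z}).closure (((M.contract {y}).delete {z}).E \ T) ∉ parCut y z U} := by
    ext T
    simp only [Set.mem_setOf_eq]
    constructor
    · rintro ⟨hT, hP⟩; exact ⟨hT, (inOut_insert_iff M h U hT.1 (Or.inl rfl)).mp hP⟩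
    · rintro ⟨hT, hP⟩; exact ⟨hT, (inOut_insert_iff M h U hT.1 (Or.inl rfl)).mpr hP⟩
  have hr : {T ∈ biIndep ((M.contract {y}).delete {z}) j |
      M.closure (insert z T) ∈ U ∧ M.closure (M.E \ insert z T) ∉ U} =
      {T ∈ biIndep ((M.contract {y}).delete {z}) j | ((M.contract {y}).delete {z}).closure T ∈ parCut y z U ∧
        ((M.contract {y}).delete {z}).closure (((M.contract {y}).delete {z}).E \ T) ∉ parCut y z U} := by
    ext T
    simp only [Set.mem_setOf_eq]
    constructor
    · rintro ⟨hT, hP⟩; exact ⟨hT, (inOut_insert_iff M h U hT.1 (Or.inr rfl)).mp hP⟩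
    · rintro ⟨hT, hP⟩; exact ⟨hT, (inOut_insert_iff M h U hT.1 (Or.inr rfl)).mpr hP⟩
  rw [hl, hr]
  ring

/-- With a parallel pair there is no in-out `0`-set. -/
lemma inOutCount_zero_of_parallel {y z : α} (h : ParallelPair M y z) (U : Set (Set α)) :
    inOutCount M U 0 = 0 := by
  unfold inOutCount
  rw [biIndep_zero_eq_empty M h]
  simp

/-- **(IO) IS CLOSED UNDER PARALLEL EXTENSION**: for a parallel pair `{y, z}` and `N = M ／ {y} ＼ {z}`,
`BiIndepInOutNormSkew N → BiIndepInOutNormSkew M` (no further hypothesis). -/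
theorem biIndepInOutNormSkew_of_parallel {y z : α} (h : ParallelPair M y z)
    (hN : BiIndepInOutNormSkew ((M.contract {y}).delete {z})) : BiIndepInOutNormSkew M := by
  intro U hU
  have hcard := ncard_ground_contract_delete M h
  have hn2 : 2 ≤ M.E.ncard := by
    have := Set.ncard_le_ncard (Set.pair_subset h.2.1.mem_ground h.2.2.1.mem_ground) M.ground_finite
    rwa [Set.ncard_pair h.1] at this
  have hN' := hN (parCut y z U) (upSetFlats_parCut M h hU)
  rw [hcard] at hN'
  have hs := SkewConv.normSkew_shift hN' 1
  rw [show M.E.ncard - 2 + 1 + 2 * 1 = M.E.ncard + 1 by omega] at hs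
  refine SkewConv.normSkew_congr (SkewConv.normSkew_add hs hs) fun k _ => ?_
  cases k with
  | zero => simp [SkewConv.shiftSeq, inOutCount_zero_of_parallel M h]
  | succ j =>
    rw [inOutCount_succ_of_parallel M h U j]
    simp only [SkewConv.shiftSeq, Nat.succ_le_succ_iff, Nat.zero_le, if_true, Nat.add_sub_cancel]
    ring

end PercRepro
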